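import Summits.RiemannHypothesis.RiemannHypothesis.Theorems.PfPersistenceRatioDegenerateWindow
import Summits.RiemannHypothesis.RiemannHypothesis.Theorems.PfPersistenceArithDialSpace
import Summits.RiemannHypothesis.RiemannHypothesis.Theorems.PfPersistenceGalerkinEvenFormDomain
import Summits.RiemannHypothesis.RiemannHypothesis.Theorems.SpectralTraceWindowStepFirstRungRegular
import HarnessLib

/-!
# PF persistence — leaf G1.21b, the `(Z)`-cell's UNGUARDED ratio classes are SETTLED RH-FREE
(cell `pub-rhpf`, barrier-prover gen 5, file 10; RULING A324 (2)(ii) upgraded from DATA to PROOF)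

long-odds MECHANISM SEARCH; no RH claims.  Everything below is PROVED (Mathlib + tree theorems; no `sorry`, no
named fact used as a hypothesis, no numerical datum); nothing here bears on the truth of RH.

RULING A324 recorded that the UNGUARDED ∀-window ratio classes `GaugeRatioClass τ` (`|ε₁| ≤ τ(ε₂ − ε₁)` at every
window) and `ModulusRatioClass κ` (`|ε₁| ≤ κ|ε₂|` at every window) force the degenerate entries `d ⟨a, 0⟩ 0 0 = 0`
(`PfPersistenceRatioDegenerateWindow`), and that `ζ`'s degenerate entries are non-zero was left as DATA.  It is a
THEOREM: the tree proves, RH-free, Yoshida's strictly regular first rung `0 < ε(a)` for `0 < a ≤ (log 3)/2`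
(`SpectralTraceWindowStep.weilGroundEnergy_pos_of_le_log_three_half`), and `ε(a) ≤ ε_ev(a) ≤ ε₁(ζ(a, 0)) = ζ ⟨a, 0⟩ 0 0`
(`weilGroundEnergy_le_weilEvenGroundEnergy`, `weilEvenGroundEnergy_le_bottomRayleigh'`, `bottomRayleigh_fin_one`).

* §1 (PROVED, RH-free) `0 < ζ ⟨a, 0⟩ 0 0` for `0 < a ≤ (log 3)/2`; by locality below the first position
  (`evenBlock_eq_of_originFree`) the same entry, hence the same sign, for EVERY origin-free weight table at
  `e^{2a} < 2`.
* §2 (PROVED) a POSITIVE degenerate entry is rejected by the gauge conjunct at that window for EVERY `τ : ℝ`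
  (`ε₂ − ε₁ = max(m, 0) − m = 0 < m = |ε₁|`) and by the modulus conjunct for every `κ < 1`.
* §3 (PROVED, RH-free) AT `ζ`: `ζ ∉ gaugeRatioAt τ ⟨a, 0⟩` (all `τ`, `a ≤ (log 3)/2`), `ζ ∉ GaugeRatioClass τ` for
  EVERY `τ`, `ζ ∉ ModulusRatioClass κ` for every `κ < 1`; hence NO sub-class of an unguarded ratio class — and no
  sub-class of a single degenerate short-window conjunct — separates `ζ` from anything, over ANY domain (`ζ ∉ S`).
* §4 (PROVED, RH-free) THE WHOLE ORIGIN-FREE DIAL SPACE (`originFreeDialSpace ⊇ arithDialSpace ∋ ζ`, every dial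
  `dial p K ζ`) is DISJOINT from `GaugeRatioClass τ` (all `τ`) and from `ModulusRatioClass κ` (`κ < 1`): for the
  unguarded classes the dial-isolation theorems of files 2–6 hold UNCONDITIONALLY and binder-free, for the trivial
  reason; the cluster-binder packages (`ClusterBinders`, `ClusterReady`) keep their content only for the GUARDED
  classes `GaugeRatioClassPos` / `ModulusRatioClassPos` (`PfPersistenceRatioGuardedIsolation`), which are untouched
  here.  Beyond `(log 3)/2` the sign of `ζ ⟨a, 0⟩ 0 0` stays DATA.
-/

set_option linter.dupNamespace false  -- the mandated namespace repeats `RiemannHypothesis`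

noncomputable section

open Real Set Matrix

open Literature.NumberTheory.LFunctions

namespace Summit.RiemannHypothesis.RiemannHypothesis.Theorems.PfPersistence

/-! ## §1 Strict positivity of the degenerate entries on short windows (RH-free) -/

/-- **PROVED (RH-free): `0 < ζ ⟨a, 0⟩ 0 0` for `0 < a ≤ (log 3)/2`** — Yoshida's strictly regular first rung
`0 < ε(a)` pushed up `ε(a) ≤ ε_ev(a) ≤ ε₁(ζ(a, 0)) = ζ ⟨a, 0⟩ 0 0`. [folklore] -/
theorem zeta_entry_N0_pos {a : ℝ} (ha : 0 < a) (h : a ≤ Real.log 3 / 2) : 0 < zetaDatum ⟨a, 0, ha⟩ 0 0 := by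
  have h1 : 0 < weilGroundEnergy a :=
    Summit.RiemannHypothesis.RiemannHypothesis.Theorems.SpectralTraceWindowStep.weilGroundEnergy_pos_of_le_log_three_half
      ha h
  have h2 : weilGroundEnergy a ≤ weilEvenGroundEnergy a := weilGroundEnergy_le_weilEvenGroundEnergy a
  have h3 : weilEvenGroundEnergy a ≤ bottomRayleigh (zetaDatum ⟨a, 0, ha⟩) :=
    weilEvenGroundEnergy_le_bottomRayleigh' ⟨a, 0, ha⟩
  have h4 : bottomRayleigh (zetaDatum ⟨a, 0, ha⟩) = zetaDatum ⟨a, 0, ha⟩ 0 0 := bottomRayleigh_fin_one _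
  linarith

/-- PROVED: `e^{2a} < 2` gives `a ≤ (log 3)/2` (indeed `a < (log 2)/2`). [folklore] -/
theorem le_log_three_half_of_exp_lt_two {a : ℝ} (h2 : Real.exp (2 * a) < 2) : a ≤ Real.log 3 / 2 := by
  have h : 2 * a < Real.log 2 := by
    rw [Real.lt_log_iff_exp_lt (by norm_num : (0 : ℝ) < 2)]; exact h2
  have h23 : Real.log 2 < Real.log 3 := Real.log_lt_log (by norm_num) (by norm_num)
  linarith

/-- PROVED: `e^{2·(1/5)} < 2` (`2/5 < log 2`). [folklore] -/
theorem exp_two_mul_fifth_lt_two : Real.exp (2 * (1 / 5 : ℝ)) < 2 := by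
  have hlog : (2 : ℝ) * (1 / 5) < Real.log 2 := by
    have := Real.log_two_gt_d9
    norm_num at this ⊢
    linarith
  calc Real.exp (2 * (1 / 5)) < Real.exp (Real.log 2) := Real.exp_lt_exp.2 hlog
    _ = 2 := Real.exp_log (by norm_num)

/-- PROVED: `1/5 ≤ (log 3)/2`. [folklore] -/
theorem fifth_le_log_three_half : (1 / 5 : ℝ) ≤ Real.log 3 / 2 :=
  le_log_three_half_of_exp_lt_two exp_two_mul_fifth_lt_two

/-- PROVED: `ζ`'s table is origin-free. [folklore] -/
theorem zetaWeights_mem_originFreeWeights : zetaWeights ∈ originFreeWeights :=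
  arithWeights_subset_originFreeWeights zetaWeights_mem_arithWeights

/-- **PROVED (RH-free): below the first position every origin-free table has `ζ`'s POSITIVE degenerate entry** —
`0 < (datumOf w) ⟨a, 0⟩ 0 0` for `w ∈ originFreeWeights`, `e^{2a} < 2` (`evenBlock_eq_of_originFree`). [folklore] -/
theorem entry_N0_pos_of_originFree {w : Weights} (hw : w ∈ originFreeWeights) {a : ℝ} (ha : 0 < a)
    (h2 : Real.exp (2 * a) < 2) : 0 < datumOf w ⟨a, 0, ha⟩ 0 0 := by
  have heq : evenBlock w ⟨a, 0, ha⟩ = evenBlock zetaWeights ⟨a, 0, ha⟩ :=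
    evenBlock_eq_of_originFree hw zetaWeights_mem_originFreeWeights (win := ⟨a, 0, ha⟩) h2
  have hζ := zeta_entry_N0_pos ha (le_log_three_half_of_exp_lt_two h2)
  show 0 < evenBlock w ⟨a, 0, ha⟩ 0 0
  rw [heq]
  exact hζ

/-! ## §2 A positive degenerate entry is rejected — by the gauge conjunct for EVERY `τ`, by the modulus conjunct
for every `κ < 1` -/

/-- **PROVED: the gauge conjunct at a degenerate window rejects every datum with a POSITIVE entry there, for EVERY
`τ : ℝ`** (`ε₁ = m > 0`, `ε₂ = max(m, 0) = m`, so `|ε₁| ≤ τ(ε₂ − ε₁) = 0` fails). [folklore] -/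
theorem not_mem_gaugeRatioAt_N0_of_entry_pos {d : Datum} {a : ℝ} (ha : 0 < a) (hpos : 0 < d ⟨a, 0, ha⟩ 0 0)
    (τ : ℝ) : d ∉ gaugeRatioAt τ ⟨a, 0, ha⟩ := by
  intro h
  simp only [gaugeRatioAt, Set.mem_setOf_eq] at h
  have hb : bottomRayleigh (d ⟨a, 0, ha⟩) = d ⟨a, 0, ha⟩ 0 0 := bottomRayleigh_fin_one _
  have hs : secondRayleigh (d ⟨a, 0, ha⟩) = max (d ⟨a, 0, ha⟩ 0 0) 0 := secondRayleigh_fin_one _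
  have hg : bottomGapGauge d ⟨a, 0, ha⟩ = 0 := by
    show secondRayleigh (d ⟨a, 0, ha⟩) - bottomRayleigh (d ⟨a, 0, ha⟩) = 0
    rw [hb, hs, max_eq_left hpos.le, sub_self]
  rw [hg, hb, mul_zero, abs_of_pos hpos] at h
  exact absurd h (not_le.2 hpos)

/-- PROVED: the modulus conjunct at a degenerate window rejects a positive entry for every `κ < 1`. [folklore] -/
theorem not_mem_modulusRatioAt_N0_of_entry_pos {d : Datum} {a : ℝ} (ha : 0 < a) (hpos : 0 < d ⟨a, 0, ha⟩ 0 0)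
    {κ : ℝ} (hκ : κ < 1) : d ∉ modulusRatioAt κ ⟨a, 0, ha⟩ :=
  fun h => hpos.ne' (entry_eq_zero_of_mem_modulusRatioAt_N0 ha hκ h)

/-- PROVED: a positive degenerate entry excludes the datum from `GaugeRatioClass τ` for EVERY `τ`. [folklore] -/
theorem not_mem_gaugeRatioClass_of_entry_pos {d : Datum} {a : ℝ} (ha : 0 < a) (hpos : 0 < d ⟨a, 0, ha⟩ 0 0)
    (τ : ℝ) : d ∉ GaugeRatioClass τ :=
  fun h => not_mem_gaugeRatioAt_N0_of_entry_pos ha hpos τ (h ⟨a, 0, ha⟩)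

/-- PROVED: a positive degenerate entry excludes the datum from `ModulusRatioClass κ`, `κ < 1`. [folklore] -/
theorem not_mem_modulusRatioClass_of_entry_pos {d : Datum} {a : ℝ} (ha : 0 < a) (hpos : 0 < d ⟨a, 0, ha⟩ 0 0)
    {κ : ℝ} (hκ : κ < 1) : d ∉ ModulusRatioClass κ :=
  fun h => not_mem_modulusRatioAt_N0_of_entry_pos ha hpos hκ (h ⟨a, 0, ha⟩)

/-! ## §3 AT `ζ` (RH-free): the unguarded ratio classes, and every degenerate short-window conjunct, EXCLUDE `ζ` -/

/-- **PROVED (RH-free): `ζ ∉ gaugeRatioAt τ ⟨a, 0⟩` for every `τ : ℝ` and every `0 < a ≤ (log 3)/2`.** [folklore] -/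
theorem zeta_not_mem_gaugeRatioAt_N0 {a : ℝ} (ha : 0 < a) (h : a ≤ Real.log 3 / 2) (τ : ℝ) :
    zetaDatum ∉ gaugeRatioAt τ ⟨a, 0, ha⟩ :=
  not_mem_gaugeRatioAt_N0_of_entry_pos ha (zeta_entry_N0_pos ha h) τ

/-- PROVED (RH-free): `ζ ∉ modulusRatioAt κ ⟨a, 0⟩` for every `κ < 1` and every `0 < a ≤ (log 3)/2`. [folklore] -/
theorem zeta_not_mem_modulusRatioAt_N0 {a : ℝ} (ha : 0 < a) (h : a ≤ Real.log 3 / 2) {κ : ℝ} (hκ : κ < 1) :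
    zetaDatum ∉ modulusRatioAt κ ⟨a, 0, ha⟩ :=
  not_mem_modulusRatioAt_N0_of_entry_pos ha (zeta_entry_N0_pos ha h) hκ

/-- **PROVED (RH-free): `ζ ∉ GaugeRatioClass τ` for EVERY `τ : ℝ`** — the unguarded `(Z)`-cell gauge class does not
contain `ζ` (witness window `(1/5, 0)`). [folklore] -/
theorem zeta_not_mem_gaugeRatioClass (τ : ℝ) : zetaDatum ∉ GaugeRatioClass τ :=
  not_mem_gaugeRatioClass_of_entry_pos (by norm_num : (0 : ℝ) < 1 / 5)
    (zeta_entry_N0_pos (by norm_num) fifth_le_log_three_half) τ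

/-- **PROVED (RH-free): `ζ ∉ ModulusRatioClass κ` for every `κ < 1`.** [folklore] -/
theorem zeta_not_mem_modulusRatioClass {κ : ℝ} (hκ : κ < 1) : zetaDatum ∉ ModulusRatioClass κ :=
  not_mem_modulusRatioClass_of_entry_pos (by norm_num : (0 : ℝ) < 1 / 5)
    (zeta_entry_N0_pos (by norm_num) fifth_le_log_three_half) hκ

/-- **PROVED (RH-free) — THE UNGUARDED GAUGE ROW IS SETTLED: no `S ⊆ GaugeRatioClass τ` separates `ζ` from
anything, over ANY domain, for ANY `τ`** (`ζ ∉ S`). [folklore] -/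
theorem not_separates_of_subset_gaugeRatioClass {S : Set Datum} {τ : ℝ} (hS : S ⊆ GaugeRatioClass τ)
    (D : Set Datum) : ¬ Separates S D zetaDatum :=
  fun hsep => zeta_not_mem_gaugeRatioClass τ (hS hsep.1)

/-- **PROVED (RH-free) — THE UNGUARDED MODULUS ROW IS SETTLED for `κ < 1`.** [folklore] -/
theorem not_separates_of_subset_modulusRatioClass {S : Set Datum} {κ : ℝ} (hS : S ⊆ ModulusRatioClass κ)
    (hκ : κ < 1) (D : Set Datum) : ¬ Separates S D zetaDatum :=
  fun hsep => zeta_not_mem_modulusRatioClass hκ (hS hsep.1)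

/-- PROVED (RH-free): even ONE degenerate short-window gauge conjunct excludes `ζ` — no `S ⊆ gaugeRatioAt τ ⟨a, 0⟩`,
`a ≤ (log 3)/2`, separates `ζ` from anything. [folklore] -/
theorem not_separates_of_subset_gaugeRatioAt_N0 {S : Set Datum} {τ a : ℝ} {ha : 0 < a}
    (hS : S ⊆ gaugeRatioAt τ ⟨a, 0, ha⟩) (h : a ≤ Real.log 3 / 2) (D : Set Datum) : ¬ Separates S D zetaDatum :=
  fun hsep => zeta_not_mem_gaugeRatioAt_N0 ha h τ (hS hsep.1)

/-- PROVED (RH-free): the modulus twin, `κ < 1`. [folklore] -/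
theorem not_separates_of_subset_modulusRatioAt_N0 {S : Set Datum} {κ a : ℝ} {ha : 0 < a}
    (hS : S ⊆ modulusRatioAt κ ⟨a, 0, ha⟩) (hκ : κ < 1) (h : a ≤ Real.log 3 / 2) (D : Set Datum) :
    ¬ Separates S D zetaDatum :=
  fun hsep => zeta_not_mem_modulusRatioAt_N0 ha h hκ (hS hsep.1)

/-! ## §4 The whole origin-free dial space is excluded (RH-free) -/

/-- **PROVED (RH-free): every origin-free datum lies outside `GaugeRatioClass τ`, for every `τ`.** [folklore] -/
theorem datumOf_not_mem_gaugeRatioClass_of_originFree {w : Weights} (hw : w ∈ originFreeWeights) (τ : ℝ) :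
    datumOf w ∉ GaugeRatioClass τ :=
  not_mem_gaugeRatioClass_of_entry_pos (by norm_num : (0 : ℝ) < 1 / 5)
    (entry_N0_pos_of_originFree hw (by norm_num) exp_two_mul_fifth_lt_two) τ

/-- PROVED (RH-free): every origin-free datum lies outside `ModulusRatioClass κ`, `κ < 1`. [folklore] -/
theorem datumOf_not_mem_modulusRatioClass_of_originFree {w : Weights} (hw : w ∈ originFreeWeights) {κ : ℝ}
    (hκ : κ < 1) : datumOf w ∉ ModulusRatioClass κ :=
  not_mem_modulusRatioClass_of_entry_pos (by norm_num : (0 : ℝ) < 1 / 5)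
    (entry_N0_pos_of_originFree hw (by norm_num) exp_two_mul_fifth_lt_two) hκ

/-- **PROVED (RH-free): `GaugeRatioClass τ` is DISJOINT from the origin-free dial space, for every `τ`.** [folklore] -/
theorem disjoint_gaugeRatioClass_originFreeDialSpace (τ : ℝ) : Disjoint (GaugeRatioClass τ) originFreeDialSpace := by
  refine Set.disjoint_right.2 ?_
  rintro _ ⟨w, hw, rfl⟩
  exact datumOf_not_mem_gaugeRatioClass_of_originFree hw τ

/-- PROVED (RH-free): `GaugeRatioClass τ` is disjoint from the arithmetic dial space, for every `τ`. [folklore] -/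
theorem disjoint_gaugeRatioClass_arithDialSpace (τ : ℝ) : Disjoint (GaugeRatioClass τ) arithDialSpace :=
  (disjoint_gaugeRatioClass_originFreeDialSpace τ).mono_right arithDialSpace_subset_originFreeDialSpace

/-- PROVED (RH-free): `ModulusRatioClass κ`, `κ < 1`, is disjoint from the origin-free dial space. [folklore] -/
theorem disjoint_modulusRatioClass_originFreeDialSpace {κ : ℝ} (hκ : κ < 1) :
    Disjoint (ModulusRatioClass κ) originFreeDialSpace := by
  refine Set.disjoint_right.2 ?_
  rintro _ ⟨w, hw, rfl⟩
  exact datumOf_not_mem_modulusRatioClass_of_originFree hw hκ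

/-- PROVED (RH-free): `ModulusRatioClass κ`, `κ < 1`, is disjoint from the arithmetic dial space. [folklore] -/
theorem disjoint_modulusRatioClass_arithDialSpace {κ : ℝ} (hκ : κ < 1) :
    Disjoint (ModulusRatioClass κ) arithDialSpace :=
  (disjoint_modulusRatioClass_originFreeDialSpace hκ).mono_right arithDialSpace_subset_originFreeDialSpace

/-- **PROVED (RH-free): NO dial of `ζ` — any position `p`, any amplitude `K` — lies in `GaugeRatioClass τ`, for any
`τ`** (binder-free; compare the cluster-binder isolation theorems for the GUARDED class). [folklore] -/
theorem dial_not_mem_gaugeRatioClass (p : ℕ) (K τ : ℝ) : datumOf (dial p K zetaWeights) ∉ GaugeRatioClass τ :=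
  datumOf_not_mem_gaugeRatioClass_of_originFree (dial_mem_originFreeWeights p K zetaWeights_mem_originFreeWeights) τ

/-- PROVED (RH-free): no dial of `ζ` lies in `ModulusRatioClass κ`, `κ < 1` (binder-free). [folklore] -/
theorem dial_not_mem_modulusRatioClass (p : ℕ) (K : ℝ) {κ : ℝ} (hκ : κ < 1) :
    datumOf (dial p K zetaWeights) ∉ ModulusRatioClass κ :=
  datumOf_not_mem_modulusRatioClass_of_originFree (dial_mem_originFreeWeights p K zetaWeights_mem_originFreeWeights)
    hκ

/-- **PROVED (RH-free) — SUMMARY for the ledger (RULING A324 (2)(ii) made a theorem):** for every `τ : ℝ` and every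
`κ < 1`, (i) `ζ ∉ GaugeRatioClass τ` and `ζ ∉ ModulusRatioClass κ`; (ii) both classes miss the whole origin-free
dial space; (iii) no sub-class of either separates `ζ` over any domain. [folklore] -/
theorem unguardedRatioClasses_settled (τ : ℝ) {κ : ℝ} (hκ : κ < 1) :
    zetaDatum ∉ GaugeRatioClass τ ∧ zetaDatum ∉ ModulusRatioClass κ ∧
      Disjoint (GaugeRatioClass τ) originFreeDialSpace ∧ Disjoint (ModulusRatioClass κ) originFreeDialSpace ∧
      (∀ S D : Set Datum, S ⊆ GaugeRatioClass τ → ¬ Separates S D zetaDatum) ∧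
      ∀ S D : Set Datum, S ⊆ ModulusRatioClass κ → ¬ Separates S D zetaDatum :=
  ⟨zeta_not_mem_gaugeRatioClass τ, zeta_not_mem_modulusRatioClass hκ,
    disjoint_gaugeRatioClass_originFreeDialSpace τ, disjoint_modulusRatioClass_originFreeDialSpace hκ,
    fun _ D hS => not_separates_of_subset_gaugeRatioClass hS D,
    fun _ D hS => not_separates_of_subset_modulusRatioClass hS hκ D⟩

end Summit.RiemannHypothesis.RiemannHypothesis.Theorems.PfPersistence

end
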